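import Summits.FinalStateConjecture.FinalStateConjecture.Theses.ZeroEnergyKerrOrBomb
import Literature.Geometry.Lorentzian.OpensChartGeodesicODE
import Literature.Geometry.Lorentzian.KerrSchildCoord

/-!
# `KerrNoZeroEnergyTrapping` (stmt-FinalStateConjecture-10023, route ZeroEnergyKerrOrBomb)

Proof of the support item `KerrNoZeroEnergyTrapping` of route `ZeroEnergyKerrOrBomb` of the
Final State Conjecture, AS TYPED: in the subextremal ingoing Kerr–Schild exterior chart
(`Kerr.exterior M a`, metric `Kerr.smoothMetric M a r₊`), an affinely parametrised geodesic
`γ` on `[0, ∞)` with null velocity (and `g(∂_{t*}, γ̇) = 0`) is not contained in any compact subset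
of the chart: `∀ K, IsCompact K → ∃ s ≥ 0, γ s ∉ K`.

## The argument (non-imprisonment by a temporal function)

As the route's refuters observed, the typed statement is the non-imprisonment property of null
geodesic rays in the (stably causal) Kerr exterior and does not exercise the zero-energy clause or
Carter's constant (Hawking–Ellis 1973, Prop. 6.4.7; O'Neill 1983, Ch. 14, Lemma 13, for strongly
causal compact sets). We give a direct quantitative proof from the Kerr–Schild form
`g = η + 2H ℓ ⊗ ℓ`, `H ≥ 0` (`M ≥ 0`):

1. *Null cone.* `g(w, w) = 0` forces `|w⃗|² = (w⁰)² − 2H ℓ(w)² ≤ (w⁰)²`, so `‖w‖² ≤ 2 (w⁰)²`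
   and a nonzero null vector has `w⁰ = dt*(w) ≠ 0` (`norm_sq_le_of_bilin_eq_zero`). Hence along
   `γ` the function `u = (t* ∘ γ)' = γ̇⁰` never vanishes and, being continuous, has constant sign.
2. *Geodesic equations in the chart* (`OpensChart.hasDerivAt_of_isGeodesicOn`, O'Neill 1983,
   Ch. 3, Cor. 21): `(γ̇)' = −Γ(γ̇, γ̇)`, and `dt*(Γ(w, w)) = −g(V, Γ(w, w)) = −½ K(w, w, V)` for the
   time vector `V = −g♯dt*` and the Koszul form `K` of the components
   (`christoffel_apply_zero`); on a compact `K ⊆ exterior`, `|K_y(w, w, V_y)| ≤ C ‖w‖²`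
   (`exists_koszulForm_timeVector_bound`: `∂g` and `V` are continuous on `{r > 0}`). So
   `|u'| ≤ C u²` while `γ` stays in `K`.
3. *One-dimensional blow-up* (`not_bounded_of_deriv_sq_bound`): `log |u| + C t*∘γ` is monotone,
   so `|u| ≥ m > 0` as long as `t* ∘ γ` is bounded, whence `|t* ∘ γ|` grows at least linearly —
   contradicting the boundedness of `t*` on the compact set `K`.

The closing theorem is `kerrNoZeroEnergyTrapping_proof`. The intended, stronger "no spatially
confined zero-energy null geodesics" (confinement modulo the flow of `∂_{t*}`, where Carter's
potential `R(r) = a²L² − Δ(L² + Q)` enters) is a different statement and is not addressed here.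

## References

* S. W. Hawking, G. F. R. Ellis, *The large scale structure of space-time*, CUP 1973, §6.4,
  Prop. 6.4.7 (non-imprisonment).
* B. O'Neill, *Semi-Riemannian geometry*, Academic Press 1983, Ch. 3, Cor. 21 (geodesic
  equations in a chart); Ch. 14, Lemma 13.
* M. Dafermos, I. Rodnianski, arXiv:0811.0354, §5.1 (`t*` and `−g♯dt*` in the ingoing
  Kerr–Schild chart).
-/

noncomputable section

namespace Summit.FinalStateConjecture.FinalStateConjecture.Theorems

open Set Filter Literature.Geometry.Lorentzian
open scoped Manifold ContDiff Topology

/-! ### One-dimensional blow-up -/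

/-- **No bounded time function along a complete ray (positive branch).** If `T : ℝ → ℝ` has
derivative `u` and `u` has derivative `u'` at every `s ≥ 0`, with `u 0 > 0`, `u s ≠ 0` and
`|u' s| ≤ C u(s)²` for `s ≥ 0`, then `T` is unbounded on `[0, ∞)`: `log u + C T` is
non-decreasing, so `u ≥ u(0) e^{-2CB} > 0` as long as `|T| ≤ B`, and then `T` grows linearly.
This is the one-dimensional core of the non-imprisonment lemma for affinely parametrised causal
geodesics in a compact set carrying a temporal function. [folklore] -/
theorem not_bounded_of_deriv_sq_bound {T u u' : ℝ → ℝ} {C B : ℝ} (hC : 0 ≤ C)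
    (hT : ∀ s, 0 ≤ s → HasDerivAt T (u s) s) (hu : ∀ s, 0 ≤ s → HasDerivAt u (u' s) s)
    (h0 : 0 < u 0) (hne : ∀ s, 0 ≤ s → u s ≠ 0)
    (hu' : ∀ s, 0 ≤ s → |u' s| ≤ C * u s ^ 2) (hB : ∀ s, 0 ≤ s → |T s| ≤ B) : False := by
  -- `u` stays positive (intermediate value theorem)
  have hpos : ∀ s, 0 ≤ s → 0 < u s := by
    intro s hs
    refine lt_of_not_ge fun hle ↦ ?_
    have hcont : ContinuousOn u (Icc 0 s) := fun t ht ↦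
      (hu t ht.1).continuousAt.continuousWithinAt
    obtain ⟨c, hc, hc0⟩ := intermediate_value_Icc' hs hcont ⟨hle, h0.le⟩
    exact hne c hc.1 hc0
  -- `h = log u + C T` is non-decreasing on `[0, ∞)`
  have hh : ∀ s, 0 ≤ s →
      HasDerivAt (fun s ↦ Real.log (u s) + C * T s) (u' s / u s + C * u s) s := fun s hs ↦
    ((hu s hs).log (hpos s hs).ne').fun_add ((hT s hs).const_mul C)
  have hmono : MonotoneOn (fun s ↦ Real.log (u s) + C * T s) (Ici 0) := by
    refine monotoneOn_of_hasDerivWithinAt_nonneg (convex_Ici 0)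
      (f' := fun s ↦ u' s / u s + C * u s)
      (fun s hs ↦ (hh s hs).continuousAt.continuousWithinAt) ?_ ?_
    · intro s hs
      rw [interior_Ici] at hs
      exact (hh s (le_of_lt hs)).hasDerivWithinAt
    · intro s hs
      rw [interior_Ici] at hs
      have hu0 := hpos s (le_of_lt hs)
      have h1 : -(C * u s) ≤ u' s / u s := by
        rw [le_div_iff₀ hu0]
        have := neg_abs_le (u' s)
        have := hu' s (le_of_lt hs)
        nlinarith
      linarith
  -- hence `u ≥ m > 0` on `[0, ∞)`
  have hB0 : 0 ≤ B := (abs_nonneg _).trans (hB 0 le_rfl)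
  set m : ℝ := Real.exp (Real.log (u 0) - 2 * C * B) with hm_def
  have hm : 0 < m := Real.exp_pos _
  have hum : ∀ s, 0 ≤ s → m ≤ u s := by
    intro s hs
    have h1 : Real.log (u 0) + C * T 0 ≤ Real.log (u s) + C * T s :=
      hmono (mem_Ici.2 le_rfl) (mem_Ici.2 hs) hs
    have hT0 := abs_le.1 (hB 0 le_rfl)
    have hTs := abs_le.1 (hB s hs)
    have h2 : Real.log (u 0) - 2 * C * B ≤ Real.log (u s) := by nlinarith
    calc m ≤ Real.exp (Real.log (u s)) := Real.exp_le_exp.2 h2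
      _ = u s := Real.exp_log (hpos s hs)
  -- so `T s ≥ T 0 + m s`
  have hlin : MonotoneOn (fun s ↦ T s - m * s) (Ici 0) := by
    have hd : ∀ s, 0 ≤ s → HasDerivAt (fun s ↦ T s - m * s) (u s - m) s := fun s hs ↦
      (hT s hs).fun_sub (hasDerivAt_const_mul m)
    refine monotoneOn_of_hasDerivWithinAt_nonneg (convex_Ici 0) (f' := fun s ↦ u s - m)
      (fun s hs ↦ (hd s hs).continuousAt.continuousWithinAt) ?_ ?_
    · intro s hs
      rw [interior_Ici] at hs
      exact (hd s (le_of_lt hs)).hasDerivWithinAt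
    · intro s hs
      rw [interior_Ici] at hs
      linarith [hum s (le_of_lt hs)]
  set s₀ : ℝ := (2 * B + 1) / m with hs₀_def
  have hs₀ : 0 ≤ s₀ := by positivity
  have h1 : T 0 - m * 0 ≤ T s₀ - m * s₀ := hlin (mem_Ici.2 le_rfl) (mem_Ici.2 hs₀) hs₀
  have h2 : m * s₀ = 2 * B + 1 := by rw [hs₀_def]; field_simp
  have hT0 := abs_le.1 (hB 0 le_rfl)
  have hTs := abs_le.1 (hB s₀ hs₀)
  linarith

/-- **No bounded time function along a complete ray.** As `not_bounded_of_deriv_sq_bound`, for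
`u` of either sign: `u s ≠ 0` for all `s ≥ 0` (apply the positive branch to `(T, u)` or to
`(-T, -u)`). [folklore] -/
theorem not_bounded_of_deriv_sq_bound' {T u u' : ℝ → ℝ} {C B : ℝ} (hC : 0 ≤ C)
    (hT : ∀ s, 0 ≤ s → HasDerivAt T (u s) s) (hu : ∀ s, 0 ≤ s → HasDerivAt u (u' s) s)
    (hne : ∀ s, 0 ≤ s → u s ≠ 0)
    (hu' : ∀ s, 0 ≤ s → |u' s| ≤ C * u s ^ 2) (hB : ∀ s, 0 ≤ s → |T s| ≤ B) : False := by
  rcases lt_or_gt_of_ne (hne 0 le_rfl) with h0 | h0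
  · refine not_bounded_of_deriv_sq_bound (T := fun s ↦ -T s) (u := fun s ↦ -u s)
      (u' := fun s ↦ -u' s) (C := C) (B := B) hC (fun s hs ↦ (hT s hs).fun_neg)
      (fun s hs ↦ (hu s hs).fun_neg)
      (neg_pos.2 h0) (fun s hs ↦ neg_ne_zero.2 (hne s hs)) (fun s hs ↦ ?_) (fun s hs ↦ ?_)
    · rw [abs_neg, neg_sq]; exact hu' s hs
    · rw [abs_neg]; exact hB s hs
  · exact not_bounded_of_deriv_sq_bound hC hT hu h0 hne hu' hB

/-! ### Kerr–Schild chart estimates -/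

/-- **Continuity of the Koszul form against the time vector.** The scalar function
`(y, w) ↦ K_y(w, w, V_y) = ∂_w g(w, V) + ∂_w g(V, w) − ∂_V g(w, w)` (`OpensChart.koszulForm` of
the Kerr–Schild components, `V = Kerr.timeVector`) is continuous at every `(y, w)` with
`r(y) > 0`. The components are real-analytic on `{r > 0}` (`Kerr.contDiffAt_bilin`); each term
`p ↦ ∂_{X p} g_{p.1}(Y p, v p)` is read as a partial derivative of the scalar family
`(p, y) ↦ g_y(Y p, v p)` (Mathlib's parametric `ContDiffAt.fderiv`), so that no operator norm of
the trilinear map `∂g_y` is needed (the step is the one of `contDiffAt_fderiv_bilin` in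
`Literature/Barriers/FinalStateConjecture/TrappingDerivativeLossGeodesicBeamsChart.lean`).
[folklore] -/
theorem continuousAt_koszulForm_timeVector (M a : ℝ) {q : E4 × E4}
    (hq : 0 < Kerr.radius a q.1) :
    ContinuousAt (fun q : E4 × E4 ↦
      OpensChart.koszulForm (Kerr.bilin M a) q.1 q.2 q.2 (Kerr.timeVector M a q.1)) q := by
  -- partial derivatives of the components along `C¹` data are continuous
  have key : ∀ {X Y v : E4 × E4 → E4}, ContDiffAt ℝ (0 + 1) X q → ContDiffAt ℝ (0 + 1) Y q →
      ContDiffAt ℝ (0 + 1) v q →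
      ContDiffAt ℝ 0 (fun p : E4 × E4 ↦ fderiv ℝ (Kerr.bilin M a) p.1 (X p) (Y p) (v p)) q := by
    intro X Y v hX hY hv
    have hξ : ContDiffAt ℝ (0 + 1) (Prod.fst : E4 × E4 → E4) q := contDiffAt_fst
    have hf : ContDiffAt ℝ (0 + 1)
        (Function.uncurry fun (p : E4 × E4) (y : E4) ↦ Kerr.bilin M a y (Y p) (v p)) (q, q.1) := by
      have h1 : ContDiffAt ℝ (0 + 1) (Kerr.bilin M a ∘ Prod.snd) (q, q.1) :=
        (Kerr.contDiffAt_bilin M a hq).comp (q, q.1) contDiffAt_snd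
      exact (h1.clm_apply (hY.comp (q, q.1) contDiffAt_fst)).clm_apply
        (hv.comp (q, q.1) contDiffAt_fst)
    have h2 : ContDiffAt ℝ 0
        (fun p : E4 × E4 ↦ fderiv ℝ (fun y ↦ Kerr.bilin M a y (Y p) (v p)) p.1) q :=
      hf.fderiv (hξ.of_le le_self_add) le_rfl
    have h3 : ContDiffAt ℝ 0
        (fun p : E4 × E4 ↦ fderiv ℝ (fun y ↦ Kerr.bilin M a y (Y p) (v p)) p.1 (X p)) q :=
      h2.clm_apply (hX.of_le le_self_add)
    have hev : ∀ᶠ p : E4 × E4 in 𝓝 q, 0 < Kerr.radius a p.1 :=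
      hξ.continuousAt.preimage_mem_nhds
        ((isOpen_lt continuous_const (Kerr.continuous_radius a)).mem_nhds hq)
    refine h3.congr_of_eventuallyEq ?_
    filter_upwards [hev] with p hp
    exact (OpensChart.fderiv_apply₂ (Kerr.bilin M a)
      ((Kerr.contDiffAt_bilin M a hp (n := 1)).differentiableAt one_ne_zero) (Y p) (v p) (X p)).symm
  have hV : ContDiffAt ℝ (0 + 1) (fun p : E4 × E4 ↦ Kerr.timeVector M a p.1) q :=
    (Kerr.contDiffAt_timeVector M a hq).comp q contDiffAt_fst
  have h1 := key contDiffAt_snd contDiffAt_snd hV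
  have h2 := key contDiffAt_snd hV contDiffAt_snd
  have h3 := key hV contDiffAt_snd contDiffAt_snd
  simp only [OpensChart.koszulForm_apply]
  exact ((h1.add h2).sub h3).continuousAt

/-- Homogeneity of the Koszul form in its two vector slots:
`K_y(c w, c w, Z) = c² K_y(w, w, Z)`. [folklore] -/
theorem koszulForm_smul_smul (G : E4 → E4 →L[ℝ] E4 →L[ℝ] ℝ) (y : E4) (c : ℝ) (w Z : E4) :
    OpensChart.koszulForm G y (c • w) (c • w) Z = c ^ 2 * OpensChart.koszulForm G y w w Z := by
  rw [OpensChart.koszulForm_smul_mid, LinearMap.smul_apply, LinearMap.smul_apply,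
    LinearMap.map_smul₂, smul_eq_mul, smul_eq_mul]
  ring

/-- **Uniform bound for the Koszul form of the Kerr–Schild components against the time vector
on a compact set.** For `K ⊆ Kerr.exterior M a` compact there is `C ≥ 0` with
`|K_y(w, w, V_y)| ≤ C ‖w‖²` for `y ∈ K`, `w ∈ E4`: the continuous function
`(y, w) ↦ K_y(w, w, V_y)` is bounded on the compact set `K × {‖w‖ ≤ 1}`, and it is homogeneous of
degree two in `w`. [folklore] -/
theorem exists_koszulForm_timeVector_bound (M a : ℝ) {K : Set (Kerr.exterior M a)}
    (hK : IsCompact K) :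
    ∃ C : ℝ, 0 ≤ C ∧ ∀ y ∈ K, ∀ w : E4,
      |OpensChart.koszulForm (Kerr.bilin M a) (y : E4) w w (Kerr.timeVector M a y)| ≤
        C * ‖w‖ ^ 2 := by
  have hKc : IsCompact ((Subtype.val '' K) ×ˢ Metric.closedBall (0 : E4) 1) :=
    (hK.image continuous_subtype_val).prod (isCompact_closedBall 0 1)
  have hcont : ContinuousOn (fun q : E4 × E4 ↦
      OpensChart.koszulForm (Kerr.bilin M a) q.1 q.2 q.2 (Kerr.timeVector M a q.1))
      ((Subtype.val '' K) ×ˢ Metric.closedBall (0 : E4) 1) := by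
    rintro q ⟨⟨y, -, hyq⟩, -⟩
    refine (continuousAt_koszulForm_timeVector M a ?_).continuousWithinAt
    rw [← hyq]
    exact Kerr.radius_pos_of_mem_region y.2
  obtain ⟨C, hC⟩ := hKc.exists_bound_of_continuousOn hcont
  refine ⟨max C 0, le_max_right _ _, fun y hy w ↦ ?_⟩
  by_cases hw : w = 0
  · subst hw
    simp
  · have hn : 0 < ‖w‖ := norm_pos_iff.2 hw
    set e : E4 := ‖w‖⁻¹ • w with he
    have hwe : ‖w‖ • e = w := by
      rw [he, smul_smul, mul_inv_cancel₀ hn.ne', one_smul]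
    have hem : ((y : E4), e) ∈ (Subtype.val '' K) ×ˢ Metric.closedBall (0 : E4) 1 := by
      refine ⟨⟨y, hy, rfl⟩, ?_⟩
      rw [Metric.mem_closedBall, dist_zero_right, he, norm_smul, norm_inv, norm_norm,
        inv_mul_cancel₀ hn.ne']
    have hb := hC _ hem
    rw [Real.norm_eq_abs] at hb
    calc |OpensChart.koszulForm (Kerr.bilin M a) (y : E4) w w (Kerr.timeVector M a y)|
        = |OpensChart.koszulForm (Kerr.bilin M a) (y : E4) (‖w‖ • e) (‖w‖ • e)
            (Kerr.timeVector M a y)| := by rw [hwe]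
      _ = ‖w‖ ^ 2 * |OpensChart.koszulForm (Kerr.bilin M a) (y : E4) e e
            (Kerr.timeVector M a y)| := by
          rw [koszulForm_smul_smul, abs_mul, abs_of_nonneg (sq_nonneg _)]
      _ ≤ ‖w‖ ^ 2 * max C 0 := by gcongr; exact hb.trans (le_max_left _ _)
      _ = max C 0 * ‖w‖ ^ 2 := by ring

/-- **Null cone of a Kerr–Schild metric with `M ≥ 0`.** If `g_x(w, w) = 0` for the Kerr–Schild
form `g = η + 2H ℓ ⊗ ℓ` (`H = M r³/(r⁴ + a² z²) ≥ 0`), then `‖w‖² ≤ 2 (w⁰)²`: indeed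
`|w⃗|² = (w⁰)² − 2H ℓ(w)² ≤ (w⁰)²`. In particular a nonzero null vector has `w⁰ = dt*(w) ≠ 0`
(`t*` is a temporal function of the chart; Dafermos–Rodnianski arXiv:0811.0354, §5.1).
[folklore] -/
theorem norm_sq_le_of_bilin_eq_zero {M : ℝ} (hM : 0 ≤ M) (a : ℝ) (x w : E4)
    (hw : Kerr.bilin M a x w w = 0) : ‖w‖ ^ 2 ≤ 2 * w 0 ^ 2 := by
  rw [Kerr.bilin_apply, Minkowski.bilin_apply] at hw
  rw [EuclideanSpace.real_norm_sq_eq, Fin.sum_univ_succ]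
  have hH := Kerr.scalarH_nonneg hM a x
  have hl : 0 ≤ 2 * Kerr.scalarH M a x * (Kerr.nullCovector a x w * Kerr.nullCovector a x w) := by
    have := mul_self_nonneg (Kerr.nullCovector a x w)
    positivity
  have hs : ∑ i : Fin 3, w i.succ ^ 2 = ∑ i : Fin 3, w i.succ * w i.succ :=
    Finset.sum_congr rfl fun i _ ↦ sq _
  nlinarith [hs]

/-- **The time component of the Christoffel map of Kerr** is minus half the Koszul form against
the time vector `V = −g♯(dt*)`: `dt*(Γ_y(w, w)) = −g(V, Γ_y(w, w)) = −½ K_y(w, w, V)`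
(`Kerr.bilin_timeVector`, `OpensChart.two_mul_val_christoffel`). [folklore] -/
theorem christoffel_apply_zero [Kerr.Facts] (M a : ℝ) (y : Kerr.exterior M a) (w : E4) :
    (OpensChart.christoffel (Kerr.smoothMetric M a (Kerr.rPlus M a)).toPseudoRiemannianMetric
        (Kerr.bilin M a) y w w : E4) 0 =
      -(2⁻¹ * OpensChart.koszulForm (Kerr.bilin M a) (y : E4) w w (Kerr.timeVector M a y)) := by
  set Γ : E4 := OpensChart.christoffel
    (Kerr.smoothMetric M a (Kerr.rPlus M a)).toPseudoRiemannianMetric (Kerr.bilin M a) y w w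
    with hΓ
  have hr : 0 < Kerr.radius a (y : E4) := Kerr.radius_pos_of_mem_region y.2
  have h1 : Kerr.bilin M a y (Kerr.timeVector M a y) Γ = -Γ 0 := Kerr.bilin_timeVector hr Γ
  have h2 : 2 * Kerr.bilin M a y Γ (Kerr.timeVector M a y) =
      OpensChart.koszulForm (Kerr.bilin M a) (y : E4) w w (Kerr.timeVector M a y) :=
    OpensChart.two_mul_val_christoffel
      (g := (Kerr.smoothMetric M a (Kerr.rPlus M a)).toPseudoRiemannianMetric)
      (G := Kerr.bilin M a) y w w (Kerr.timeVector M a y)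
  rw [Kerr.bilin_symm] at h1
  linarith

/-- **Non-imprisonment in the Kerr–Schild chart, analytic form.** Let `M ≥ 0`, `K` a compact
subset of the Kerr exterior chart, `γ : ℝ → Kerr.exterior M a` and `v : ℝ → E4` with, for all
`s ≥ 0`: `(γ)' = v`, `v' = −Γ_γ(v, v)` (the geodesic equations in the chart), `g_γ(v, v) = 0`,
`v ≠ 0`, and `γ s ∈ K`. Then `False`: with `u = v⁰ = (t* ∘ γ)'` one has `u ≠ 0`
(`norm_sq_le_of_bilin_eq_zero`), `u' = ½ K(v, v, V)` (`christoffel_apply_zero`),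
`|u'| ≤ C u²` on `K` (`exists_koszulForm_timeVector_bound`), and `t* ∘ γ` bounded on `K`,
contradicting `not_bounded_of_deriv_sq_bound'`. [folklore] -/
theorem false_of_null_geodesic_imprisoned [Kerr.Facts] {M a : ℝ} (hM : 0 ≤ M)
    {K : Set (Kerr.exterior M a)} (hK : IsCompact K) {γ : ℝ → Kerr.exterior M a} {v : ℝ → E4}
    (hc : ∀ s, 0 ≤ s → HasDerivAt (fun t ↦ (γ t : E4)) (v s) s)
    (hv : ∀ s, 0 ≤ s → HasDerivAt v
      (-OpensChart.christoffel (Kerr.smoothMetric M a (Kerr.rPlus M a)).toPseudoRiemannianMetric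
        (Kerr.bilin M a) (γ s) (v s) (v s)) s)
    (hnull : ∀ s, 0 ≤ s → Kerr.bilin M a (γ s) (v s) (v s) = 0 ∧ v s ≠ 0)
    (hmem : ∀ s, 0 ≤ s → γ s ∈ K) : False := by
  -- the time function `T = t* ∘ γ`, `u = T' = v⁰`, `u' = ½ K(v, v, V)`
  have hT : ∀ s, 0 ≤ s → HasDerivAt (fun t ↦ (γ t : E4) 0) (v s 0) s := fun s hs ↦
    (EuclideanSpace.proj (𝕜 := ℝ) (0 : Fin 4)).hasFDerivAt.comp_hasDerivAt s (hc s hs)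
  have hu : ∀ s, 0 ≤ s → HasDerivAt (fun t ↦ v t 0)
      (2⁻¹ * OpensChart.koszulForm (Kerr.bilin M a) (γ s : E4) (v s) (v s)
        (Kerr.timeVector M a (γ s))) s := by
    intro s hs
    have h := (EuclideanSpace.proj (𝕜 := ℝ) (0 : Fin 4)).hasFDerivAt.comp_hasDerivAt s (hv s hs)
    refine h.congr_deriv ?_
    rw [PiLp.proj_apply, PiLp.neg_apply, christoffel_apply_zero, neg_neg]
  -- the null cone: `‖v‖² ≤ 2 u²`, `u ≠ 0`
  have hcone : ∀ s, 0 ≤ s → ‖v s‖ ^ 2 ≤ 2 * v s 0 ^ 2 ∧ v s 0 ≠ 0 := by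
    intro s hs
    obtain ⟨hvv, hv0⟩ := hnull s hs
    have h1 := norm_sq_le_of_bilin_eq_zero hM a _ _ hvv
    refine ⟨h1, fun h0 ↦ hv0 ?_⟩
    have h2 : ‖v s‖ ^ 2 ≤ 0 := by
      have : v s 0 ^ 2 = 0 := by rw [h0]; ring
      linarith
    have h3 : ‖v s‖ = 0 := by nlinarith [norm_nonneg (v s)]
    exact norm_eq_zero.1 h3
  -- the bound `|u'| ≤ C u²` on `K`
  obtain ⟨C, hC, hCK⟩ := exists_koszulForm_timeVector_bound M a hK
  have hu' : ∀ s, 0 ≤ s → |2⁻¹ * OpensChart.koszulForm (Kerr.bilin M a) (γ s : E4) (v s) (v s)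
      (Kerr.timeVector M a (γ s))| ≤ C * v s 0 ^ 2 := by
    intro s hs
    rw [abs_mul, abs_of_pos (by norm_num : (0 : ℝ) < 2⁻¹)]
    have h2 := hCK (γ s) (hmem s hs) (v s)
    have h3 := (hcone s hs).1
    nlinarith
  -- `t*` is bounded on `K`
  obtain ⟨B, hB⟩ := hK.exists_bound_of_continuousOn
    (f := fun y : Kerr.exterior M a ↦ (y : E4) 0)
    ((EuclideanSpace.proj (𝕜 := ℝ) (0 : Fin 4)).continuous.comp continuous_subtype_val).continuousOn
  have hTB : ∀ s, 0 ≤ s → |(γ s : E4) 0| ≤ B := fun s hs ↦ by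
    have h := hB (γ s) (hmem s hs)
    rwa [Real.norm_eq_abs] at h
  exact not_bounded_of_deriv_sq_bound' hC hT hu (fun s hs ↦ (hcone s hs).2) hu' hTB

/-- **Kerr sanity check of route ZeroEnergyKerrOrBomb: no null geodesic ray of the subextremal
Kerr exterior is imprisoned in a compact set** (item stmt-FinalStateConjecture-10023,
`KerrNoZeroEnergyTrapping`). As typed, the statement asks that an affinely parametrised null
geodesic `γ : [0, ∞) → Kerr.exterior M a` (with `g(∂_{t*}, γ̇) = 0`) leave every compact subset
of the exterior chart; this is non-imprisonment, and the proof does not need the zero-energy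
clause (nor Carter's constant): the Kerr–Schild time `t*` is a temporal function
(`dt*(w) ≠ 0` on nonzero null vectors, quantitatively `‖w‖² ≤ 2 dt*(w)²` since `H ≥ 0`,
`norm_sq_le_of_bilin_eq_zero`), so `u = (t* ∘ γ)'` has constant sign; by the geodesic equations
in the chart (`OpensChart.hasDerivAt_of_isGeodesicOn`, O'Neill 1983, Ch. 3, Cor. 21)
`u' = −dt*(Γ(γ̇, γ̇)) = ½ K(γ̇, γ̇, V)`, which on a compact `K` is bounded by `C u²`
(`exists_koszulForm_timeVector_bound`); then `log |u| + C t*` is monotone along `γ`, `|u|` is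
bounded below and `t* ∘ γ` is unbounded (`not_bounded_of_deriv_sq_bound'`), contradicting the
boundedness of `t*` on `K` (Hawking–Ellis 1973, Prop. 6.4.7 / O'Neill 1983, Ch. 14, Lemma 13 for
the general non-imprisonment lemma; the intended spatially-confined version modulo the flow of
`∂_{t*}` is a different statement). [folklore] -/
theorem kerrNoZeroEnergyTrapping_proof :
    Summit.FinalStateConjecture.FinalStateConjecture.Theses.ZeroEnergyKerrOrBomb.KerrNoZeroEnergyTrapping := by
  intro _ _ M a hMa γ hγ hnull K hK
  by_contra hcon
  simp only [not_exists, not_and, not_not] at hcon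
  refine false_of_null_geodesic_imprisoned hMa.pos.le hK (γ := γ)
    (v := fun s ↦ velocity 𝓘(ℝ, E4) γ s) (fun s hs ↦ ?_) (fun s hs ↦ ?_)
    (fun s hs ↦ (hnull s hs).1) hcon
  · exact (OpensChart.hasDerivAt_of_isGeodesicOn
      (g := (Kerr.smoothMetric M a (Kerr.rPlus M a)).toPseudoRiemannianMetric)
      (G := Kerr.bilin M a) (fun _ ↦ rfl) (fun y ↦ Kerr.differentiableAt_bilin M a y) hγ
      (mem_Ici.2 hs)).1
  · exact (OpensChart.hasDerivAt_of_isGeodesicOn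
      (g := (Kerr.smoothMetric M a (Kerr.rPlus M a)).toPseudoRiemannianMetric)
      (G := Kerr.bilin M a) (fun _ ↦ rfl) (fun y ↦ Kerr.differentiableAt_bilin M a y) hγ
      (mem_Ici.2 hs)).2

end Summit.FinalStateConjecture.FinalStateConjecture.Theorems

end
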